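import Summits.BirchSwinnertonDyer.BirchSwinnertonDyer.Theorems.RamifiedHeegnerPairLeafRankZeroUpperAtThreeTwistUnit
import Summits.BirchSwinnertonDyer.BirchSwinnertonDyer.Theorems.SmallImageMuTransferMuTransferStubCm
import Summits.BirchSwinnertonDyer.Rank1Residual.GaloisImage.TorsionIsoImageObstruction
import HarnessLib

/-!
# Route `RamifiedHeegnerPair`, residual crux U₀ `LeafRankZeroUpperAtThree` (26024) RESTRICTED to the `3Nn` rank-zero rows — the circle-free
# supply for rhp-p1's NT 27201: U₀|3Nn ⟸ PUB₀⁺ ∧ S2 ∧ Σ★″ ∧ TU₀|3Nn (twist-unit road, row-restricted)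

HONEST FRAMING. Theorems only; helper file (`--supports stmt-BirchSwinnertonDyer-26024`); nothing is booked, no item is closed, BSD is not proved for
any curve; CONDITIONAL on every displayed input. Lead prover bsd-line-rhp-p2 g7, 2026-08-28; sequel of `…LeafRankZeroUpperAtThreeTwistUnit.lean`
(p631701: U₀ ⟸ PUB₀⁺ ∧ S2 ∧ Σ★″ ∧ TU₀, neither L₁ nor L₀).

WHY. Line `kolyvagin_split` v5 of the deciding crux L₁ (26021, lead rhp-p1 g6) registers as its fifth stub `stub_leafRankZeroUpper_nonsplitRows` =
U₀ RESTRICTED to the `3Nn` rank-zero rows (`ρ̄_{W,3}` not onto), consumed at the rank-zero twists of the `3Nn` rank-one rows; the route's own U₀ line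
consumed L₁ at those twists — the L₁|3Nn ↔ U₀|3Nn circle (pen 10:56:12Z; rhp-p1 12:00:52Z: «U₀|3Nn has exactly two circle-free sources: a
small-image ℚ-method (none) or TU₀|3Nn ∧ the rank-zero T1⁺ readings»). This file lands the second source with the twist-unit supply asked ONLY on
the rows where the circle lives:

* `leafRankZeroUpper_nonsplitRows_of_pubManin_of_divisibilityReading_of_sigmaStar_of_twistUnitZeroNonsplit` — the text of rhp-p1's
  `Sig.stub_leafRankZeroUpper_nonsplitRows` VERBATIM (∀ non-CM leaf `W`, `r_an(W) = 0`, `¬ ρ̄_{W,3}` onto → `Typed.MissingUpperBoundAt W 3`) ⟸ PUB₀⁺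
  (skeleton splitkolyvagin0 v5's print conjunction) ∧ S2 (27492 BY NAME) ∧ Σ★″ (27493 BY NAME) ∧ TU₀|3Nn, where TU₀|3Nn := TU₀ (the rank-zero-side
  twist-unit datum of p631701, inline) asked only for non-CM leaf curves of analytic rank `0` with `ρ̄_{W,3}` NOT onto. The one new step w.r.t.
  p631701 §5: the optimal member `W₀ ∼ W` is again `3Nn` — `E[3]` is irreducible on the leaf, so a `ℚ`-isogeny restricts to a `Γ_ℚ`-isomorphism
  `E[3] ≃ E₀[3]` (`exists_torsionIso_of_isIsogenous_of_irreducible`) and surjectivity of `ρ̄₃` is transported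
  (`GaloisImage.hasSurjectiveModNGaloisRep_iff_of_torsionIso`).

CONSEQUENCE (mod print, rhp-p1's p625317 §10 / ColumnAssembly): NT 27201 ⟸ STRUCT ∧ A₃ₙₙ ∧ S2 ∧ Σ★″ ∧ TU₀|3Nn — acyclic. TU₀|3Nn is research
(not print; surplus over the leaf), per class an exact certificate. BSD is not proved; U₀, NT, TU₀ are OPEN.
References: [cite: Serre1972, §2.4 Prop. 15] [cite: MilneADT2006, Thm. I.7.3] [cite: CastellaGrossiLeeSkinner2022, proof of Thm. 5.3.1, display (5.6)]
[cite: MatarNekovar2019, Thm. 0.7 (p. 456) and §0.11 (p. 457)] [cite: Jetchev2008, Conj. 1.3, Thm. 1.4 (p. 812)] [cite: Miller2011LMS, §1 and Def. 1.1].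
-/

-- D-0017: single-problem summit, so `Summit.BirchSwinnertonDyer.BirchSwinnertonDyer.…` repeats a namespace BY DESIGN.
set_option linter.dupNamespace false
set_option autoImplicit false

noncomputable section

open scoped Classical NumberField

open WeierstrassCurve IsDedekindDomain IsDedekindDomain.HeightOneSpectrum NumberField
  Rat.HeightOneSpectrum Literature Literature.NumberTheory.EllipticCurves
  Literature.NumberTheory.EllipticCurves.ModularForms
  Literature.NumberTheory.EllipticCurves.Rank1Residual
  Literature.NumberTheory.EllipticCurves.Rank1Residual.Typed
  Literature.NumberTheory.EllipticCurves.KrizLi2019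
  Literature.NumberTheory.QuadraticFields
  Summit.BirchSwinnertonDyer.Rank1Residual
  Summit.BirchSwinnertonDyer.Rank1Residual.Additive
  Summit.BirchSwinnertonDyer.Rank1Residual.X11b.Three
  Summit.BirchSwinnertonDyer.BirchSwinnertonDyer.Theses.RamifiedHeegnerPair
  Summit.BirchSwinnertonDyer.BirchSwinnertonDyer.Theorems
  Summit.BirchSwinnertonDyer.BirchSwinnertonDyer.Theorems.SchneiderFree

namespace Summit.BirchSwinnertonDyer.BirchSwinnertonDyer.Theorems.RamifiedPairUpperBound

/-- **U₀ on the `3Nn` rank-zero rows (rhp-p1's `stub_leafRankZeroUpper_nonsplitRows`, text VERBATIM) ⟸ PUB₀⁺ ∧ S2 ∧ Σ★″ ∧ TU₀|3Nn.** PUB₀⁺ =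
the print conjunction of skeleton `splitkolyvagin0` v5 VERBATIM; S2 = item 27492, Σ★″ = item 27493 BY NAME; TU₀|3Nn = the rank-zero-side twist-unit
datum (a Heegner field `K` — imaginary quadratic, `d_K` odd, Heegner for `N_W` — with `L(W^{(d_K)},s)` vanishing simply at `1`, and a member `W₂ ∼ W`
whose twist model `W₂d` has `#Ш_an = q`, `ord₃ q ≤ 0`) asked only at non-CM leaf curves of analytic rank `0` with `ρ̄_{W,3}` NOT onto. NEITHER L₁ NOR
L₀ is a hypothesis. Proof: p631701 §4 at the optimal member `W₀ ∼ W` (modularity alone), which is again non-CM, leaf, of analytic rank `0` AND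
`3Nn` (irreducible `E[3]` ⇒ a `Γ_ℚ`-isomorphism `E[3] ≃ E₀[3]` along the isogeny, so `ρ̄₃` onto for `W₀` would make it onto for `W`), then Cassels
+ GZK + Version L back to `W`. CONDITIONAL on every displayed input; nothing asserted; BSD is not proved. [cite: Serre1972, §2.4 Prop. 15]
[cite: MilneADT2006, Thm. I.7.3] [cite: MatarNekovar2019, Thm. 0.7 (p. 456)] [cite: Jetchev2008, Conj. 1.3, Thm. 1.4 (p. 812)] [cite: Miller2011LMS, Def. 1.1] -/
theorem leafRankZeroUpper_nonsplitRows_of_pubManin_of_divisibilityReading_of_sigmaStar_of_twistUnitZeroNonsplit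
    (hpub : (∀ (N : ℕ) [NeZero N] (W : WeierstrassCurve ℚ) (K : Type) [Field K] [NumberField K],
        Literature.NumberTheory.EllipticCurves.gross_zagier N W K) ∧
      (∀ (N : ℕ) [NeZero N] (W : WeierstrassCurve ℚ) (K : Type) [Field K] [NumberField K],
        Literature.NumberTheory.EllipticCurves.kolyvagin N W K) ∧
      Literature.NumberTheory.EllipticCurves.rank_eq_analyticRank_of_analyticRank_le_one ∧
      WeierstrassCurve.hasEntireLFunction_rat ∧
      Literature.NumberTheory.EllipticCurves.MatarNekovar2019.thm07_padicValNat_card_sha_primary_add_le_of_globalDivisibility_of_irreducible ∧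
      Literature.NumberTheory.EllipticCurves.ModularForms.exists_isNewformOf ∧
      Literature.NumberTheory.EllipticCurves.bumpFriedbergHoffstein_exists_heegnerField_split_twist_simpleZero ∧
      Literature.NumberTheory.EllipticCurves.ModularForms.nonempty_modularParametrizationData ∧
      WeierstrassCurve.bsdRHS_eq_of_isIsogenous ∧
      Literature.NumberTheory.EllipticCurves.ModularForms.mazur_not_dvd_maninConstant_of_odd ∧
      Literature.NumberTheory.EllipticCurves.ModularForms.abbesUllmo_not_dvd_maninConstant_of_not_dvd_level ∧
      Literature.NumberTheory.EllipticCurves.ModularForms.cesnavicius_not_two_dvd_maninConstant_of_two_dvd_level)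
    (hD : JetchevDivisibilityReadingS2) (hStar : LeafSigmaStarDivisibilityAtThreeOptimalOffRows)
    (hTU : ∀ (W : WeierstrassCurve ℚ) [W.IsElliptic] [W.IsGloballyMinimal], ¬ W.HasCM →
      Literature.NumberTheory.EllipticCurves.Rank1Residual.Addv W 3 →
      Summit.BirchSwinnertonDyer.Rank1Residual.Additive.SubGss W 3 → W.analyticRank = 0 →
      ¬ W.HasSurjectiveModNGaloisRep 3 →
      ∃ (K : Type) (_ : Field K) (_ : NumberField K) (W₂ W₂d : WeierstrassCurve ℚ) (_ : W₂.IsElliptic)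
        (_ : W₂.IsGloballyMinimal) (_ : W₂d.IsElliptic) (_ : W₂d.IsGloballyMinimal),
        IsImaginaryQuadratic K ∧ Odd (NumberField.discr K) ∧ SatisfiesHeegnerHypothesis (W.conductorNorm ℤ) K ∧
        (W.quadraticTwist (NumberField.discr K : ℚ)).entireLFunction 1 = 0 ∧
        deriv (W.quadraticTwist (NumberField.discr K : ℚ)).entireLFunction 1 ≠ 0 ∧
        IsIsogenous W W₂ ∧ (∃ C : VariableChange ℚ, C • W₂.quadraticTwist (NumberField.discr K : ℚ) = W₂d) ∧
        ∃ qd : ℚ, shaAn W₂d = (qd : ℂ) ∧ padicValRat 3 qd ≤ 0) :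
    ∀ (W : WeierstrassCurve ℚ) [W.IsElliptic] [W.IsGloballyMinimal], ¬ W.HasCM →
      Literature.NumberTheory.EllipticCurves.Rank1Residual.Addv W 3 →
      Summit.BirchSwinnertonDyer.Rank1Residual.Additive.SubGss W 3 → W.analyticRank = 0 →
      ¬ W.HasSurjectiveModNGaloisRep 3 →
      Literature.NumberTheory.EllipticCurves.Rank1Residual.Typed.MissingUpperBoundAt W 3 := by
  intro W _ _ hCM hadd hsub hr hns
  obtain ⟨hGZ, hKo, hGZK, hmod, hMN, hnf, -, hmodP, hCassels, hM, hAU, hC2⟩ := hpub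
  obtain ⟨W₀, hW₀, hW₀', N, hN0, D₀, hiso, hN₀, -, hopt, hCM₀, hadd₀, hsub₀, hr₀⟩ :=
    exists_optimal_leaf_member hnf W hCM hadd hsub
  haveI := hW₀
  haveI := hW₀'
  haveI := hN0
  have hr₀' : W₀.analyticRank = 0 := hr₀.trans hr
  -- the optimal member is again `3Nn`: `E[3] ≃ E₀[3]` as `Γ_ℚ`-modules along the isogeny (irreducibility on the leaf)
  have hirr : W.HasIrreducibleModPGaloisRep 3 := (classX4_three_of_addv_of_subGss W hadd hsub).2.2
  obtain ⟨e, he⟩ :=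
    Summit.BirchSwinnertonDyer.BirchSwinnertonDyer.Rank1Residual.exists_torsionIso_of_isIsogenous_of_irreducible
      (p := 3) hirr hiso
  have hns₀ : ¬ W₀.HasSurjectiveModNGaloisRep 3 := fun h ↦
    hns ((GaloisImage.hasSurjectiveModNGaloisRep_iff_of_torsionIso e he).mpr h)
  -- settle U₀ at `W₀`, where TU₀|3Nn applies
  have h₀ : MissingUpperBoundAt W₀ 3 := by
    subst hN₀
    exact leafRankZeroUpper_three_of_latticeOptimal_of_divisibilityReading_of_sigmaStar_of_twistUnitZero hGZ hKo hGZK hmod hMN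
      hnf hCassels hmodP hM hAU hC2 hD hStar W₀ hCM₀ hadd₀ hsub₀ hr₀' D₀ hopt (hTU W₀ hCM₀ hadd₀ hsub₀ hr₀' hns₀)
  -- and transport it back along `W ∼ W₀`
  exact missingUpperBoundAt_of_isIsogenous_of_analyticRank_le_one hCassels hGZK hmod (by rw [hr]; exact zero_le_one) hiso h₀

end Summit.BirchSwinnertonDyer.BirchSwinnertonDyer.Theorems.RamifiedPairUpperBound

end
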